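/-
Copyright (c) 2026 the pub-hodgecm-mathlib formalisation cell (harness21).  Prover seat hodgecm-mathlib-K2Liu-p13 (g2), Track B «K2-LIT»,
#184♮ = hLiu418 = `stmt-HodgeConjecture-24832`; Road I v3 organ U1-CT-ind STAGE 2 (Q2), file F5-j (LEAD F0P6-plan (g14) 10:39:33Z ∕ 11:15:51Z «F4 → F5 → D-U1 stage 3 =»).
-/
import Summits.HodgeConjecture.HodgeConjecture.Theorems.K2LiuKlingenCellOneEisensteinU              -- ★ F5-f (+ ★ F5-b, F4-3b, F1, ★ E1 `eisensteinSeriesU`)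
import Summits.HodgeConjecture.HodgeConjecture.Theorems.K2LiuSiegelCharacterTrivialOnRational       -- ★ #10a `siegelDeltaCharacter_eq_one_of_mem_ratH`
import HarnessLib

/-!
# Crux `HLiu418`, Road I v3, organ U1 stage 2 (Q2), file F5-j: THE RESTRICTED SECTION `i^*f_h : y ↦ f(Ψ(m_Q(1,y)) h)` IS LEFT-`B₂(L⁺)`-INVARIANT —
# E1's hypothesis `hf` for `eisensteinSeriesU_term_eq ∕ _eq_tsum ∕ _rational_mul`, and the AUTOMORPHY of term 1 of `E_Q` on the Klingen Levi

Cell `hodgecm-mathlib`, crux item hLiu418 = `stmt-HodgeConjecture-24832`; squad K2 ∕ K2Liu; LEAD F0P6-plan (g14), co-dealer K2E5-plan (g7); prover K2Liu-p13 (g2).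
THEOREMS ONLY (no `def`, no instance, no notation, no named-fact hypothesis, no `sorry`); lane `--supports stmt-HodgeConjecture-24832 --as helper` (count-neutral).
E1's Borel Eisenstein API (★ `K2E1BorelEisensteinUDefs`: `eisensteinSeriesU_term_eq`, `_eq_tsum`, `_rational_mul`, `_eq_apply_add_tsum_unipotent_two`) is stated for
sections `f` that are LEFT-`B(F)`-INVARIANT: `hf : ∀ b ∈ borelU c J, ∀ x, f (toAdelic b · x) = f x`.  For the restricted Siegel section of ★ F5-f,
`i^*f_h(y) = f(Ψ(jAdelic₄ m_Q^𝔸(1, (jAdelic 2)⁻¹ y)) · h)`, this holds UNCONDITIONALLY: `m_Q(1,b) ∈ P(L⁺)` for `b ∈ B₂(L⁺)` (★ F1 `klingenLevi_mem_siegelFour_iff`,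
★ F4-3b `isSiegelDelta_transport_toAdelic_iff`), the section transforms by the inducing character, and the character is `1` on `H(L⁺)` (★ #10a, product formula).
* **`restrictedSection_borelU_mul`** — E1's `hf` for `i^*f_h`;
* **`eisensteinSeriesU_restrictedSection_rational_mul`** — `E^{U(J₂)}(i^*f_h)(toAdelic γ · g₂) = E^{U(J₂)}(i^*f_h)(g₂)` for every `γ ∈ U(J₂)(L⁺)` (★ E1 `eisensteinSeriesU_rational_mul`):
  term 1 of `E_Q` is AUTOMORPHIC on the Klingen Levi — clause (T3)-type input of ★ G0 `K2LiuKlingenConstantTermFamilyClauses` for `T₁`;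
* `eisensteinSeriesU_restrictedSection_term_eq` — independence of the coset representatives (★ E1 `eisensteinSeriesU_term_eq`).
[MoeglinWaldspurger1995, II.1.5, II.1.7], [Rogawski1990, §2.2], [Garrett2018, §2.10, §3.10], [Liu2021, §B.3 p. 101].
HONEST LABEL.  Count-neutral helper: `HC_CM` is proved only modulo the 7 printed citations (2 remaining named inputs: hLiu418 = `stmt-HodgeConjecture-24832`,
h413 = `stmt-HodgeConjecture-24833`) until rung 0 closes.
-/

set_option autoImplicit false
set_option linter.dupNamespace false -- the mandated namespace repeats `HodgeConjecture.HodgeConjecture`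

noncomputable section

open scoped Matrix
open NumberField IsDedekindDomain MulAction

namespace Summit.HodgeConjecture.HodgeConjecture.Cruxes.HLiu418.K2LiuKlingenRestrictedSectionBorelU

open Literature.NumberTheory.Automorphic Literature.NumberTheory.Automorphic.UnitaryGroup
open Literature.NumberTheory.GelbartRogawski1991 Literature.NumberTheory.GelbartRogawski1991.GRConstruction
open Literature.NumberTheory.GaloisRepresentations
open Literature.NumberTheory.K2Lit.SiegelDoubled
open Summit.HodgeConjecture.HodgeConjecture.Cruxes.HLiu418.K2LiuDoubledUTwoTwoBorelFrame
open Summit.HodgeConjecture.HodgeConjecture.Cruxes.HLiu418.K2LiuKlingenParabolicDefs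
open Summit.HodgeConjecture.HodgeConjecture.Cruxes.HLiu418.K2LiuKlingenUnipotentAdelicDefs
open Summit.HodgeConjecture.HodgeConjecture.Cruxes.HLiu418.K2LiuKlingenRationalCells (complexConj_ringHom_apply_apply transport_toAdelic_mem_ratH)
open Summit.HodgeConjecture.HodgeConjecture.Cruxes.HLiu418.K2LiuKlingenCellXiOrbits (isSiegelDelta_transport_toAdelic_iff)
open Summit.HodgeConjecture.HodgeConjecture.Cruxes.HLiu418.K2LiuKlingenCellOneEisensteinU (klingenLevi_one_mul coe_jAdelic_two_symm_toAdelic jAdelic_klingenLevi_one_symm_toAdelic)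
open Summit.HodgeConjecture.HodgeConjecture.Cruxes.HLiu418.K2LiuSiegelCharacterTrivialOnRational (siegelDeltaCharacter_eq_one_of_mem_ratH)
open Summit.HodgeConjecture.HodgeConjecture.Cruxes.HLiu418.K2LiuSiegelDoubledLeviMatrix (conjAdele_conjAdele')
open Summit.HodgeConjecture.HodgeConjecture.Cruxes.H413.K2E1BorelEisensteinU (eisensteinSeriesU eisensteinSeriesU_rational_mul eisensteinSeriesU_term_eq)
open Summit.HodgeConjecture.HodgeConjecture.Cruxes.H413.K2E1BruhatCosetsU (mem_borelU_iff_apply_eq_zero_two)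
open UnitaryDualPair

variable {L : Type} [Field L] [NumberField L] [IsCMField L]
variable {N M : ℕ} {e : Fin N × Fin M ≃ Fin 2}
  {dV : Fin N → L} {hdV : ∀ i, IsCMField.complexConj L (dV i) = dV i}
  {dW : Fin M → L} {hdW : ∀ i, IsCMField.complexConj L (dW i) = dW i}

section Transport

variable {SA : GL (Fin (2 + 2)) (AdeleRing (𝓞 L) L)}
  {Ψ : (quasiSplit (Fp L) L (IsCMField.complexConj L) (2 + 2)).Adelic ≃ₜ* HA L e dV hdV dW hdW} {X Y : Matrix (Fin 2) (Fin 2) (Fp L)} {a : Fp L}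
  (hΨ : ∀ g : (quasiSplit (Fp L) L (IsCMField.complexConj L) (2 + 2)).Adelic,
    (((Ψ g : HA L e dV hdV dW hdW) : GL (Fin (2 + 2)) (AdeleRing (𝓞 L) L)) : Matrix (Fin (2 + 2)) (Fin (2 + 2)) (AdeleRing (𝓞 L) L)) =
      (SA : Matrix (Fin (2 + 2)) (Fin (2 + 2)) (AdeleRing (𝓞 L) L)) *
        ((adelicVal (Fp L) L (IsCMField.complexConj L) (2 + 2) _ g : GL (Fin (2 + 2)) (AdeleRing (𝓞 L) L)) :
          Matrix (Fin (2 + 2)) (Fin (2 + 2)) (AdeleRing (𝓞 L) L)) *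
        ((SA⁻¹ : GL (Fin (2 + 2)) (AdeleRing (𝓞 L) L)) : Matrix (Fin (2 + 2)) (Fin (2 + 2)) (AdeleRing (𝓞 L) L)))
  (ha : a + a = 1)
  (hSA : Matrix.reindex (e₂ (n := 2)).symm (e₂ (n := 2)).symm (SA : Matrix (Fin (2 + 2)) (Fin (2 + 2)) (AdeleRing (𝓞 L) L)) =
    Matrix.fromBlocks (1 : Matrix (Fin 2) (Fin 2) (AdeleRing (𝓞 L) L)) (X.map ((algebraMap L (AdeleRing (𝓞 L) L)).comp (algebraMap (Fp L) L))) 1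
      (-(X.map ((algebraMap L (AdeleRing (𝓞 L) L)).comp (algebraMap (Fp L) L)))))
  (hSAi : Matrix.reindex (e₂ (n := 2)).symm (e₂ (n := 2)).symm ((SA⁻¹ : GL (Fin (2 + 2)) (AdeleRing (𝓞 L) L)) : Matrix (Fin (2 + 2)) (Fin (2 + 2)) (AdeleRing (𝓞 L) L)) =
    Matrix.fromBlocks ((a • (1 : Matrix (Fin 2) (Fin 2) (Fp L))).map ((algebraMap L (AdeleRing (𝓞 L) L)).comp (algebraMap (Fp L) L)))
      ((a • (1 : Matrix (Fin 2) (Fin 2) (Fp L))).map ((algebraMap L (AdeleRing (𝓞 L) L)).comp (algebraMap (Fp L) L)))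
      (Y.map ((algebraMap L (AdeleRing (𝓞 L) L)).comp (algebraMap (Fp L) L)))
      (-(Y.map ((algebraMap L (AdeleRing (𝓞 L) L)).comp (algebraMap (Fp L) L)))))
  (hXY : X * Y = a • (1 : Matrix (Fin 2) (Fin 2) (Fp L))) (hYX : Y * X = a • (1 : Matrix (Fin 2) (Fin 2) (Fp L)))

include hΨ ha hSA hSAi hXY hYX in
/-- **`i^*f_h` IS LEFT-`B₂(L⁺)`-INVARIANT** (E1's hypothesis `hf`): for `b ∈ borelU c J₂` (upper triangular, rational) and `y ∈ U(J₂)(𝔸_{L⁺})`,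
`f(Ψ(jAdelic₄ m_Q^𝔸(1, j₂⁻¹(toAdelic b · y))) · h) = f(Ψ(jAdelic₄ m_Q^𝔸(1, j₂⁻¹ y)) · h)` — `Ψ(toAdelic₄ m_Q^L(1,b)) ∈ P_Δ(𝔸) ∩ H(L⁺)` acts through the inducing character,
which is `1` on rational points. [cite: MoeglinWaldspurger1995, II.1.7] [cite: Liu2021, §B.3 p. 101] [cite: Garrett2018, §2.10] -/
theorem restrictedSection_borelU_mul {χ : HeckeCharacter L} {s : ℂ} {f : HA L e dV hdV dW hdW → ℂ} (hf : IsSiegelDeltaSection L e dV hdV dW hdW χ s f) (h : HA L e dV hdV dW hdW)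
    (b : unitaryGroupOfForm ((IsCMField.complexConj L : L ≃ₐ[Fp L] L) : L →+* L) ((StdForm.antidiagonal 2).over L)) (hb : b ∈ borelU ((IsCMField.complexConj L : L ≃ₐ[Fp L] L) : L →+* L) ((StdForm.antidiagonal 2).over L))
    (y : (quasiSplit (Fp L) L (IsCMField.complexConj L) 2).Adelic) :
    f (Ψ (jAdelic L 4 (klingenLevi (AdeleRing (𝓞 L) L) (conjAdele (Fp L) L (IsCMField.complexConj L)) (conjAdele_conjAdele' L) 1 ((jAdelic L 2).symm ((quasiSplit (Fp L) L (IsCMField.complexConj L) 2).toAdelic b * y)))) * h) =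
      f (Ψ (jAdelic L 4 (klingenLevi (AdeleRing (𝓞 L) L) (conjAdele (Fp L) L (IsCMField.complexConj L)) (conjAdele_conjAdele' L) 1 ((jAdelic L 2).symm y))) * h) := by
  have hq : (quasiSplit (Fp L) L (IsCMField.complexConj L) 2).toAdelic b =
      UnitaryGroup.toAdelic (Fp L) L (IsCMField.complexConj L) 2 ((StdForm.antidiagonal 2).over L) b := rfl
  rw [hq, map_mul (jAdelic L 2).symm, klingenLevi_one_mul, map_mul, jAdelic_klingenLevi_one_symm_toAdelic, map_mul, mul_assoc]
  have hP : IsSiegelDelta L e dV hdV dW hdW (Ψ (UnitaryGroup.toAdelic (Fp L) L (IsCMField.complexConj L) (2 + 2) ((StdForm.antidiagonal (2 + 2)).over L)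
      (klingenLevi L ((IsCMField.complexConj L : L ≃ₐ[Fp L] L) : L →+* L) (complexConj_ringHom_apply_apply L) 1 b))) :=
    (isSiegelDelta_transport_toAdelic_iff hΨ ha hSA hSAi hYX _).2
      ((klingenLevi_mem_siegelFour_iff (complexConj_ringHom_apply_apply L) 1 b).2 ((mem_borelU_iff_apply_eq_zero_two _ _).1 hb))
  rw [hf _ hP, siegelDeltaCharacter_eq_one_of_mem_ratH χ s (transport_toAdelic_mem_ratH hΨ ha hSA hSAi hXY hYX _), one_mul]

include hΨ ha hSA hSAi hXY hYX in
/-- **TERM 1 OF `E_Q` IS AUTOMORPHIC ON THE KLINGEN LEVI**: `E^{U(J₂)}(i^*f_h)(toAdelic γ · g₂) = E^{U(J₂)}(i^*f_h)(g₂)` for every rational `γ ∈ U(J₂)(L⁺)` (★ E1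
`eisensteinSeriesU_rational_mul`, no convergence needed). [cite: MoeglinWaldspurger1995, II.1.5] [cite: Garrett2018, §3.10] -/
theorem eisensteinSeriesU_restrictedSection_rational_mul {χ : HeckeCharacter L} {s : ℂ} {f : HA L e dV hdV dW hdW → ℂ} (hf : IsSiegelDeltaSection L e dV hdV dW hdW χ s f)
    (h : HA L e dV hdV dW hdW) (γ : unitaryGroupOfForm ((IsCMField.complexConj L : L ≃ₐ[Fp L] L) : L →+* L) ((StdForm.antidiagonal 2).over L)) (g₂ : (quasiSplit (Fp L) L (IsCMField.complexConj L) 2).Adelic) :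
    eisensteinSeriesU (fun y : (quasiSplit (Fp L) L (IsCMField.complexConj L) 2).Adelic => f (Ψ (jAdelic L 4 (klingenLevi (AdeleRing (𝓞 L) L) (conjAdele (Fp L) L (IsCMField.complexConj L)) (conjAdele_conjAdele' L) 1 ((jAdelic L 2).symm y))) * h))
        ((quasiSplit (Fp L) L (IsCMField.complexConj L) 2).toAdelic γ * g₂) =
      eisensteinSeriesU (fun y : (quasiSplit (Fp L) L (IsCMField.complexConj L) 2).Adelic => f (Ψ (jAdelic L 4 (klingenLevi (AdeleRing (𝓞 L) L) (conjAdele (Fp L) L (IsCMField.complexConj L)) (conjAdele_conjAdele' L) 1 ((jAdelic L 2).symm y))) * h)) g₂ :=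
  eisensteinSeriesU_rational_mul (fun b hb y => restrictedSection_borelU_mul hΨ ha hSA hSAi hXY hYX hf h b hb y) γ g₂

include hΨ ha hSA hSAi hXY hYX in
/-- **INDEPENDENCE OF THE REPRESENTATIVES** for `i^*f_h`: the term of `E^{U(J₂)}(i^*f_h)(g₂)` at the coset of `γ` is `i^*f_h(toAdelic γ · g₂)` (★ E1 `eisensteinSeriesU_term_eq`).
[cite: Garrett2018, §2.10] [cite: MoeglinWaldspurger1995, II.1.5] -/
theorem eisensteinSeriesU_restrictedSection_term_eq {χ : HeckeCharacter L} {s : ℂ} {f : HA L e dV hdV dW hdW → ℂ} (hf : IsSiegelDeltaSection L e dV hdV dW hdW χ s f)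
    (h : HA L e dV hdV dW hdW) (γ : unitaryGroupOfForm ((IsCMField.complexConj L : L ≃ₐ[Fp L] L) : L →+* L) ((StdForm.antidiagonal 2).over L)) (g₂ : (quasiSplit (Fp L) L (IsCMField.complexConj L) 2).Adelic) :
    f (Ψ (jAdelic L 4 (klingenLevi (AdeleRing (𝓞 L) L) (conjAdele (Fp L) L (IsCMField.complexConj L)) (conjAdele_conjAdele' L) 1 ((jAdelic L 2).symm ((quasiSplit (Fp L) L (IsCMField.complexConj L) 2).toAdelic (Quotient.mk (orbitRel ↥(borelU ((IsCMField.complexConj L : L ≃ₐ[Fp L] L) : L →+* L) ((StdForm.antidiagonal 2).over L)) ↥(unitaryGroupOfForm ((IsCMField.complexConj L : L ≃ₐ[Fp L] L) : L →+* L) ((StdForm.antidiagonal 2).over L))) γ).out * g₂)))) * h) =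
      f (Ψ (jAdelic L 4 (klingenLevi (AdeleRing (𝓞 L) L) (conjAdele (Fp L) L (IsCMField.complexConj L)) (conjAdele_conjAdele' L) 1 ((jAdelic L 2).symm ((quasiSplit (Fp L) L (IsCMField.complexConj L) 2).toAdelic γ * g₂)))) * h) :=
  eisensteinSeriesU_term_eq (f := fun y : (quasiSplit (Fp L) L (IsCMField.complexConj L) 2).Adelic => f (Ψ (jAdelic L 4 (klingenLevi (AdeleRing (𝓞 L) L) (conjAdele (Fp L) L (IsCMField.complexConj L)) (conjAdele_conjAdele' L) 1 ((jAdelic L 2).symm y))) * h))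
    (fun b hb y => restrictedSection_borelU_mul hΨ ha hSA hSAi hXY hYX hf h b hb y) γ g₂

end Transport

end Summit.HodgeConjecture.HodgeConjecture.Cruxes.HLiu418.K2LiuKlingenRestrictedSectionBorelU

end
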